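import Mathlib
import HarnessLib
import HarnessLib.Audit
import Summits.NavierStokesRegularity.Statement
import Literature.Analysis.FluidPDE.ClassicalSolution
import Literature.Analysis.FluidPDE.LerayHopf
import Literature.Analysis.FluidPDE.SuitableWeak
import Literature.Analysis.FluidPDE.SelfSimilar
import Literature.Analysis.FluidPDE.KochTataru
import Literature.Analysis.FluidPDE.WeakSolution
import Literature.Analysis.FluidPDE.VectorCalculus
import Literature.Analysis.FluidPDE.MildSolution
import Literature.Analysis.FluidPDE.NSWave0
import Summits.NavierStokesRegularity.NavierStokesRegularity.Theorems.TypeICertificateLadderNoBlowupToClay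
import Summits.NavierStokesRegularity.NavierStokesRegularity.Theorems.SymmetryModuliCountLiouvilleKillsTypeI
import HarnessLib.Audit.Status.Attr

/-!
Route: ExtremalTypeIConstant

# Route ExtremalTypeIConstant — minimise the Type-I constant over ancient solutions — the extremal
flow must be a scaling soliton, and scaling solitons do not exist

X = TypeIAncientLiouville, the Liouville statement (L′) in the KNSS gauge with the TEMPORAL Type-I
bound — SHARED with route
SymmetryModuliCount (stmt-NavierStokesRegularity-4050, same Lean text): every smooth divergence-free
u on ℝ³×(−∞,0) solving the
Oseen-kernel integral equation u(t) = e^{(t−s)Δ}u(s) − ∫_s^t e^{(t−τ)Δ}P∇·(u⊗u)dτ for all s<t<0 (the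
gauge without parasitic b(t);
class A_C below) and obeying |u(t,x)| ≤ C/√(−t) vanishes identically. It realises idea card
least-singular-extremal-type-i-constant:
X is reached through ONE distinguished element of the class — the minimiser of the Type-I constant
C*(u) = sup_{t<0,x} √(−t)|u(t,x)|
over the nontrivial elements, normalised so that the bound is ATTAINED at the interior hot spot
(t,x) = (−1,0) ("EXTREMAL(C,u)":
u ∈ A_C, ‖u(−1,0)‖ = C, and C is the least constant for which some A_{C′} contains a nontrivial
element) — by three statements:
MinimiserExists (support: explicit gap + KNSS compactness), ExtremalSpiralSymmetry (crux 2, the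
card's Conjecture M in operative
form: extremality forces a one-parameter spiral-scaling symmetry) and SpiralScalingLiouville (crux
3: scaling solitons of the class
vanish; rotation-free case = Tsai 1998 Thm 1 at q = ∞). The Type-II half is the shared crux NoTypeII
(stmt-0056), carried as the route's declared RESIDUAL conjunct.
CONJUNCT SPLIT (tribunal D-0033, rev 3, 2026-08-17): NoBlowup = NoTypeIBlowup ∧ NoTypeII (⟺
NavierStokesRegularity, landed
noBlowup_iff_navierStokesRegularity). ATTACKED conjunct = the Type-I half NoTypeIBlowup (text of
TypeICertificateLadder's
target: a Leray–Hopf classical solution from a rapidly decaying datum with the Type-I rate extends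
past T), reached as
ExtremalSpiralSymmetry ∧ SpiralScalingLiouville ⇒ X (TargetOfCruxes + MinimiserExists, both PROVED)
⇒ NoTypeIBlowup
(LiouvilleKillsTypeI, PROVED). RESIDUAL: NoTypeII — imported complement, attacked by no item of this
route, exempt from T3/T4.
DECIDING THEOREM (rev 3): `closes : ExtremalSpiralSymmetry → SpiralScalingLiouville →
MinimiserExists → NoTypeII →
NavierStokesRegularity`; the proved frames LiouvilleKillsTypeI (stmt-4056) and NoBlowupToClay
(stmt-0055) are consumed inside the
proof through their gate-appended `_holds` theorems and are no longer binders (the round-0 kernel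
read the binder NoBlowupToClay,
a proved support, as a summit-strength crux via NoBlowup → NoBlowupToClay); MinimiserExists (PROVED,
stmt-8217) stays a binder only
because its proof file imports this module.
Lean: `∀ (C : ℝ) (u : ℝ → EuclideanSpace ℝ (Fin 3) → EuclideanSpace ℝ (Fin 3)), ContDiffOn ℝ (⊤ :
ℕ∞) (Function.uncurry u) (Set.Iio 0 ×ˢ Set.univ) ∧ (∀ t < 0,
Literature.Analysis.FluidPDE.VectorCalculus.IsDivFree (u t)) ∧ (∀ s t : ℝ, s < t → t < 0 → ∀ x, u t
x = Literature.Analysis.FluidPDE.heatFlow (u s) (t - s) x - ∫ τ in Set.Ioo s t, ∫ y,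
Literature.Analysis.FluidPDE.oseenKernel (t - τ) (x - y) (u τ y) (u τ y)) ∧
Literature.Analysis.FluidPDE.HasTypeITimeDecay C u → ∀ t < 0, ∀ x, u t x = 0`

## Assembly
Pure logic (theorem `closes`, rev 3; lean check rc 0, 0 sorries): the argument of
TargetOfCruxes gives X from ExtremalSpiralSymmetry, SpiralScalingLiouville and MinimiserExists (a
nontrivial element yields an
extremal (C*,w) with ‖w(−1,0)‖ = C* > 0, crux 2 gives its spiral-scaling symmetry, crux 3 makes w ≡
0 — contradiction); for a
finite-energy classical solution from a rapidly decaying datum on [0,T) with no smooth extension,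
(u,p) is maximal
(IsMaximalSmoothSolution := classical ∧ ¬HasSmoothExtensionPast), NoTypeII gives the Type-I rate,
LiouvilleKillsTypeI_holds with X
gives the extension — contradiction; NoBlowupToClay_holds concludes NavierStokesRegularity. Binders:
ExtremalSpiralSymmetry (open
crux), SpiralScalingLiouville (open crux), MinimiserExists (proved support), NoTypeII (residual).
Shared items: target 4050,
NoTypeII 0056, LiouvilleKillsTypeI 4056, NoBlowupToClay 0055 (letter-for-letter with
SymmetryModuliCount / TypeICertificateLadder).

Rationale: WHY THIS LINE. Kenig–Merle critical elements for Navier–Stokes minimise a DATUM norm that must blow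
up at the singularity (arXiv:0911.0500,
arXiv:1201.1592, arXiv:1012.0145, arXiv:1505.06197), so their compactness step fights
Escauriaza–Seregin–Šverák; this line minimises
instead the one scale-invariant size that is FINITE along Type-I blow-up and excludes constants by
itself, the temporal Type-I
constant, over the tangent-flow class of arXiv:0709.3599 §6 / arXiv:1811.00502 Thm 1.1, placed in
the KNSS Oseen gauge so that u = 0
and exact symmetries are meaningful. Imported from L²-critical NLS
(doi:10.1215/s0012-7094-93-06919-0 Merle: minimal-mass blow-up
= the pseudo-conformal ground state; arXiv:1001.1627 Raphaël–Szeftel: existence AND uniqueness of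
the minimal element) with the
dictionary mass ↦ C*, ground state ↦ scaling soliton (Leray / rotated-Leray profile,
arXiv:2607.09619 Rem 1.8), Merle's rigidity ↦
ExtremalSpiralSymmetry, and "ground state" ↦ EMPTY by Tsai1998 Thm 1 (q = ∞): the least singular
singularity would be the most
symmetric one, and the most symmetric one does not exist. Free by-products filed as support: the
closed-form gap C* ≥ 1/(πκ)
(SmallConstantLiouville, a two-line Picard bound in the gauge; rung zero of TypeICertificateLadder),
attainment at an interior
hot spot, and the first-order conditions there — the extremal flow is PUSHED BY PRESSURE,
−u·∇p(−1,0) ≥ C*²/2 + |∇u(−1,0)|²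
(HotSpotFirstOrder). Versus existing routes: TypeILiouville needs (L) for ALL bounded ancient
solutions (stmt-0057);
SymmetryModuliCount needs EVERY element of A_C to carry a symmetry (ForcedSymmetry, stmt-4052) and a
Liouville theorem for every
one-parameter subgroup incl. helical ones (SymmetricLiouville, stmt-4053); RecurrentProfiles selects
recurrent elements by
topological dynamics; here only the EXTREMAL element must be symmetric, it is selected variationally
with first/second-order
conditions at a marked point, and only the scaling-type Liouville theorem is needed
(SpiralScalingLiouville is the σ = 1 case of
stmt-4053, checked in Sketch.lean).

RANKED CRUXES. #0 TypeIAncientLiouville (target) — (L′) in the KNSS gauge: every element of A_C :=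
{u smooth on (−∞,0)×ℝ³, divergence-free, KNSS-mild (Oseen integral equation for all s<t<0), |u| ≤
C/√(−t)} is identically zero on t<0. Same text as SymmetryModuliCount's target
(stmt-NavierStokesRegularity-4050); implied by (L) = stmt-0057. (why it might fail: one nontrivial
Type-I ancient solution — a backward λ-DSS/RDSS profile (BradshawTsai2017CPDE Open Problem 5.1;
Tsai2018 Conj 8.8–8.9) — refutes it; the truncated dyadic model has exactly such a Type-I DSS
blow-up (TruncatedDyadicTypeIBlowup, machine-checked).) [arXiv:0709.3599, arXiv:1811.00502,
BradshawTsai2017CPDE, Literature.Barriers.NavierStokesRegularity.TruncatedDyadicTypeIBlowup]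
#2 ExtremalSpiralSymmetry (crux) — the card's Conjecture M ("C*-minimisers are isolated modulo
translations and rotations, hence scaling-fixed") in the operative form the assembly needs. Call
(C,u) EXTREMAL if u ∈ A_C, the Type-I bound is attained at the interior point (t,x) = (−1,0)
(‖u(−1,0)‖ = C; √(−t) = 1 there), and C ≤ C′ whenever A_{C′} has a nontrivial element. Then every
extremal (C,u) with C > 0 is invariant under a one-parameter group of SPIRAL SCALINGS: there are a ∈
ℝ³ and a skew A (⟪Ax,x⟫ = 0) with ∇u·(a + x + Ax) + u + 2t ∂_t u − Au ≡ 0 on t<0 —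
SymmetryModuliCount's generator L_ξ with ξ = (a, σ = 1, A); A = 0 is exact backward self-similarity
about (−a, 0) (extremality pins the blow-up time of the symmetry to T′ = 0: a soliton about T′ > 0
has sup √(−t)|u| approached only as t → −∞, never attained). Intended proof shape: Danskin one-sided
derivatives of ε ↦ C*(w_ε)² along C¹ curves of the class through u vanish in sign (orthogonality
conditions ẇ·u = 0 at the hot spot for every ancient linearised direction, identically satisfied by
the 7 symmetry generators), second-order conditions from the Hessian of F = (−t)|u|² at (−1,0),
Type-I compactness makes 'isolated' = 'locally unique', and a stabiliser meeting every scaling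
factor near 1 contains a one-parameter spiral scaling (closed-subgroup argument; arXiv:2607.09619
Rem 1.8: scaling solitons = RSS). [deps: MinimiserExists, HotSpotFirstOrder] [difficulty: XL] (why
it might fail: minimisers of a sup-functional need not be isolated mod translations/rotations: a
λ-DSS/RDSS extremal (the truncated-dyadic Type-I blow-up IS discretely self-similar) or a continuum
of symmetry-free extremals has no continuous scaling symmetry; Danskin conditions may not force
one.) [doi:10.1215/s0012-7094-93-06919-0, arXiv:1001.1627, arXiv:2607.09619, BradshawTsai2017CPDE,
ChaeWolf2017RemovingDSS, Literature.Barriers.NavierStokesRegularity.TruncatedDyadicTypeIBlowup]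
FIRST RUNG LANDED (BC5 witness):
Theorems.ExtremalSpiralSymmetry.Registered.exists_selfRecurrent_extremal
(Theorems/…SelfRecurrentExtremal.lean, sorry-free): if an extremal pair exists, some extremal pair
(C,W) is RECURRENT under the scaling semigroup modulo translations (λ_j W(λ_j²t, x_j+λ_j x) →
W(t,x), λ_j → ∞; Birkhoff recurrence of the blow-down relation on the KNSS-compact extremal set) —
the soft half of Conjecture M (approximate scaling symmetry of SOME extremal; the crux asks the
exact one-parameter symmetry of EVERY extremal). It lives on the Type-I ancient class, where S's
analogue (Type-I exclusion = NoTypeIBlowup, conjecture (L′)) is open — outside S's known regime —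
and exercises the lever (extremality + compactness ⇒ symmetry). Structural second rung:
…Registered.extremalSpiralSymmetry_of_localScalingStabiliser (local scaling stabiliser of extremals
⇒ the crux; generator stubs landed).
#3 SpiralScalingLiouville (crux) — an element of A_C invariant under a one-parameter spiral-scaling
group (generator ∇u·(a + x + Ax) + u + 2t∂_t u − Au = 0, A skew) vanishes identically. Integrating
the symmetry, u(t,x) = (−t)^{-1/2} e^{−θ(t)A} U(e^{θ(t)A}(x − x₁)/√(−t)), θ(t) = −½ log(−t), x₁ =
−(1+A)⁻¹a: a backward ROTATED self-similar solution (scaling soliton) with smooth profile that is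
merely BOUNDED (|U| ≤ C; no spatial decay). A = 0: (U,P) is a Leray profile with ν = 1, a = 1/2, U
is constant by Tsai1998 Thm 1 at q = ∞ (support BoundedProfileConstant) and constants b/√(−t)
violate the Oseen identity unless b = 0 (support SelfSimilarExcluded). A ≠ 0: bounded-profile
rotated-self-similar Liouville. Implied by SymmetryModuliCount.SymmetricLiouville (stmt-4053; σ = 1
case, checked in Sketch.lean), strictly weaker (no translation/screw-motion cases). [deps:
BoundedProfileConstant, SelfSimilarExcluded] [difficulty: L] (why it might fail: the rotated case A
≠ 0 is open even for DECAYING profiles |U| ≲ 1/(1+|y|) when α ≈ 1 (arXiv:2607.09619 Thm 1.4 covers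
|α| ≪ 1, ≫ 1; Tsai2018 Conj 8.9); here U is only bounded, and the head-pressure maximum principle of
NRŠ/Tsai has no analogue with the term α(JU − Jy·∇U).) [Tsai1998, arXiv:2607.09619,
BradshawTsai2017CPDE, arXiv:1610.05680, NecasRuzickaSverak1996] RUNGS: A = 0 proved
(SelfSimilarExcluded, BoundedProfileConstant — inside S's known regime, barrier
LeraySelfSimilarBlowupExclusion); A ≠ 0 with DECAYING profile and extreme |α|: named fact
Literature.Analysis.FluidPDE.pineauVicol2026_rss_liouville (arXiv:2607.09619 Thm 1.4); open core =
bounded profile, |α| ≈ 1 (arXiv:2607.09619 p.4: 'leaves open the case α ≈ 1'; central obstruction: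
no head-pressure maximum principle for α ≠ 0).
#4 NoTypeII (crux) — RESIDUAL conjunct of the declared conjunct split NoBlowup = NoTypeIBlowup ∧
NoTypeII (D-0033; this route attacks NoTypeIBlowup through X; exempt from T3/T4); SHARED crux
stmt-NavierStokesRegularity-0056 (routes TypeILiouville #2, SymmetryModuliCount, RecurrentProfiles,
TypeICertificateLadder, MeanFieldTypeI): a finite-energy classical solution from a rapidly decaying
datum with finite maximal lifespan T blows up at the Type-I rate ‖u(t)‖_∞ ≤ C(T−t)^{-1/2}. The
Type-II half of Clay (A); this route adds nothing to it. [difficulty: open-problem] (why it might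
fail: no theorem bounds a blow-up rate from above; Tao's averaged-NS blow-up is Type II
(arXiv:1402.0290 p.8 fn.), KNSS2009 p.4: every axisymmetric singularity is Type II, so Hou's
axisymmetric candidate (arXiv:2107.06509), if real, refutes it (= ¬Clay A).) [arXiv:1402.0290,
arXiv:0709.3599, arXiv:2107.06509, arXiv:1104.3615,
Literature.Barriers.NavierStokesRegularity.TaoAveragedBlowup]
#9 MinimiserExists (support) — attainment (card (d)): if some A_C has a nontrivial element then an
EXTREMAL (C*,w) with C* > 0 exists (C* := inf of admissible constants of nontrivial elements ≥ the
small-constant gap; minimising sequence renormalised to the hot spot (−1,0); KNSS Prop 4.1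
compactness of A_{C*+1}; pointwise limits give the sharp bound and ‖w(−1,0)‖ = C*). PROVED,
sorry-free: Theorems.extremalTypeIConstant_minimiserExists_proof
(Theorems/ExtremalTypeIConstantMinimiserExists.lean; item closed). It is still a BINDER of `closes`
for one mechanical reason: that proof file imports this route module, so the gate cannot render
`MinimiserExists_holds` here (its analytic inputs do not import it; re-landing the same proof over
the literal signature would let `closes` drop the binder). TRIBUNAL NOTE: a proved binder is
discharged, not attacked — the t0 kernel can only 'derive' it by `exact?` finding this very proof
(the round-0 artefact on NoBlowupToClay); read it as residual-by-proof (`--residual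
…NoTypeII,…MinimiserExists`). [difficulty: done] [arXiv:0709.3599, Seregin2014Notes,
arXiv:1811.00502, KochTataru2001]
#9 SmallConstantLiouville (support) — the GAP (card (c)), rung zero of TypeICertificateLadder in
closed form: there is c₀ > 0 — explicitly c₀ = 1/(πκ), κ := sup_{τ>0} √τ ‖K(τ,·)‖_{L¹(ℝ³)} the
Oseen-kernel constant — with A_C = {0} for C < c₀. Proof in the gauge: |e^{(t−s)Δ}u(s)| ≤ C/√(−s) →
0 as s → −∞ (temporal decay kills the past) and |∫_s^t∫K(t−τ,x−y)[u,u]| ≤ κC²∫_{−∞}^t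
(t−τ)^{-1/2}(−τ)^{-1}dτ = πκC²/√(−t); so C*(u) ≤ πκ C*(u)², i.e. C*(u) = 0 or C*(u) ≥ 1/(πκ).
[difficulty: provable-now] [arXiv:0709.3599, KochTataru2001, ChaeWolf2017RemovingDSS,
Seregin2014Notes]
#9 SelfSimilarExcluded (support) — the A = 0 case of SpiralScalingLiouville: an element of A_C that
is exactly backward self-similar about some (x₁, 0) (generator ∇u·(a + x) + u + 2t∂_t u = 0, x₁ =
−a) vanishes. Integrate: u(t,x) = (−t)^{-1/2}U((x−x₁)/√(−t)) with U = u(−1, x₁ + ·) smooth, |U| ≤ C;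
the gauge makes (u,p) a classical solution with the KNSS pressure, hence (U,P) a Leray profile
(IsLerayProfile 1 (1/2) U P after translating x₁ to 0); BoundedProfileConstant gives U ≡ b; then u =
b/√(−t) and the Oseen identity u(t) = e^{(t−s)Δ}u(s) (the bilinear term of a constant field
vanishes: K has zero mean / is a derivative) forces b/√(−t) = b/√(−s), b = 0. [difficulty: M]
[Tsai1998, NecasRuzickaSverak1996, arXiv:0709.3599]
#9 BoundedProfileConstant (support) — Tsai 1998 Theorem 1 at q = ∞ for the tree's pointwise profile
class: a Leray profile (U,P) (IsLerayProfile ν a U P, ν,a > 0) with U bounded is CONSTANT (print: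
"If a weak solution U of (1.3) belongs to L^q(ℝ³) for some q ∈ (3,∞], then it must be constant"; the
in-tree fact tsai_selfsimilar records only q < ∞). Provable now from in-tree pieces:
tsai1998_profile_smooth_holds (U ∈ C^∞), tsai1998_lemma32_holds (polynomial pressure growth, stated
for 3 ≤ q ≤ ⊤), |U| ≤ M ≤ b|y| for |y| ≥ M/b with any b ∈ (0,a), abs_headPressure_le +
isConst_of_driftOp_nonneg_of_poly (Lemma 5.1: Π = ½|U|² + P + a y·U constant),
IsLerayProfile.laplacian_eq_zero_of_headPressure_const_of_contDiff (ΔU = 0), then Liouville for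
BOUNDED harmonic maps in place of the L^q step of IsLerayProfile.eq_zero_of_growth. [difficulty:
provable-now] [Tsai1998, NecasRuzickaSverak1996,
Literature.Barriers.NavierStokesRegularity.LeraySelfSimilarBlowupExclusion]
#9 HotSpotFirstOrder (support) — first-order conditions at the hot spot of an extremal element (card
(e)). F(t,x) = (−t)|u(t,x)|² ≤ C² on t<0 with equality at (−1,0), an INTERIOR point, so:
∇_x|u(−1,·)|²(0) = 0; ∂_t|u(·,0)|²(−1) = C² (from ∂_tF = 0); Δ_x|u(−1,·)|²(0) ≤ 0. The gauge makes
(u,p) a classical Navier–Stokes solution on t<0 for the KNSS pressure p (KNSS §4; any admissible p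
has the same ∇p), and ∂_t|u|²/2 = u·Δu − u·(u·∇)u − u·∇p = Δ|u|²/2 − |∇u|² − ½u·∇|u|² − u·∇p gives
at (−1,0) the PRESSURE PUSH −u·∇p ≥ C²/2 + |∇u|² (so |∇p(−1,0)| ≥ C/2): the extremal ancient flow is
being accelerated by pressure at its hot spot by a quantified, scale-invariant amount. Seed of the
first-order analysis behind crux 2. [difficulty: M] [arXiv:0709.3599, Seregin2014Notes]
#9 TargetOfCruxes (support) — GLUE cruxes ⇒ target, pure logic (PROVED in the planner's Sketch.lean,
theorem targetOfCruxes_holds): ExtremalSpiralSymmetry → SpiralScalingLiouville → MinimiserExists →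
TypeIAncientLiouville. Given a nontrivial u ∈ A_C, MinimiserExists yields an extremal (C*,w) with
‖w(−1,0)‖ = C* > 0, crux 2 gives its spiral-scaling symmetry, crux 3 makes w ≡ 0 on t<0 —
contradiction with ‖w(−1,0)‖ = C* > 0. [difficulty: provable-now] [arXiv:0709.3599,
doi:10.1215/s0012-7094-93-06919-0]
#9 LiouvilleKillsTypeI (support) — SHARED support stmt-NavierStokesRegularity-4056
(SymmetryModuliCount): X ⇒ a finite-energy classical solution from a rapidly decaying datum with the
Type-I rate near T extends smoothly past T (KNSS2009 §6 Prop 6.1 zoom at near-maxima with the SAME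
constant, Prop 4.1 compactness, limit in A_C with |ū(0,0)| ≥ 1/2, X kills it). Same Lean text as
4056; PROVED (symmetryModuliCount_liouvilleKillsTypeI_proof) and, since rev 3, consumed by `closes`
through LiouvilleKillsTypeI_holds instead of being a binder. [difficulty: L] [arXiv:0709.3599,
arXiv:0804.1803, Seregin2014Notes, arXiv:1811.00502]
#9 NoBlowupToClay (support) — SHARED support stmt-NavierStokesRegularity-0055 (TypeILiouville's
assembly frame): no blow-up for finite-energy classical solutions from rapidly decaying data ⇒ Clay
(A) (local classical theory, continuation, weak–strong uniqueness, energy inequality,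
isNavierStokesSolution_and_smooth_iff). Same Lean text as 0055; PROVED
(typeICertificateLadder_noBlowupToClay_proof @ f501e9774e4d) and, since rev 3, consumed by `closes`
through NoBlowupToClay_holds instead of being a binder (its binder position was the round-0
tribunal's summit-strength finding: NoBlowup → NoBlowupToClay). [difficulty: L] [Leray1934,
FujitaKato1964, Fefferman2000]

TWO-LAYER PLAN. Foreseen glued splits (none filed now). ExtremalSpiralSymmetry ⇐
ExtremalScalingRecurrent (the card's fallback M1′: an extremal
element has a CLOSED scaling orbit modulo translations/rotations — SS, RSS, DSS or RDSS) →
NoDiscreteExtremal (a λ-DSS/RDSS extremal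
has a continuous spiral symmetry: second-order/Danskin conditions along the phase circle, or the
bounded-profile form of
TypeIDSSLiouvilleConjecture) → ExtremalSpiralSymmetry. SpiralScalingLiouville ⇐ SelfSimilarExcluded
(A = 0, filed) →
RotatedProfileLiouville (bounded-profile RSS, A ≠ 0; arXiv:2607.09619 weighted-L² method for |α| ≪
1, ≫ 1 as the first rungs) →
SpiralScalingLiouville. MinimiserExists ⇐ SmallConstantLiouville (filed) → GaugeCompactness (A_C is
closed under renormalised
C^∞_loc limits) → MinimiserExists.

KILL CRITERIA. A nontrivial element of some A_C (¬TypeIAncientLiouville: e.g. a bounded-profile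
backward DSS/RDSS Type-I soliton) refutes the target
and every Type-I route at once — close `refuted:TypeIAncientLiouville` and hand the witness to the
negative routes (DssFarFieldSlaving,
QuantisedSymmetry). A nontrivial bounded-profile ROTATED self-similar ancient solution refutes
SpiralScalingLiouville (and (L), and
SymmetryModuliCount's SymmetricLiouville) — close `refuted:SpiralScalingLiouville`.
ExtremalSpiralSymmetry is implied by the target,
so it can only be refuted together with it; but a THEOREM showing that extremals of sup-functionals
on scaling-compact classes are
generically discretely (not continuously) self-similar forces the pivot to the two-layer split (M1′
+ NoDiscreteExtremal) or a
merge into RecurrentProfiles. (L) = stmt-0057, or ForcedSymmetry ∧ SymmetricLiouville (route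
SymmetryModuliCount), proved ⇒ this
route is superseded. A finite-energy Type-II blow-up from Schwartz data refutes NoTypeII and settles
¬Clay (A).

NOT DECOMPOSED YET. How crux 2 is proved: the Danskin calculus on the argmax set, the orthogonality
conditions for ancient solutions of the
linearisation at the extremal element, the implicit-function step 'isolated ⇔ locally unique' on the
Type-I-compact moduli
space, and the closed-subgroup step (stabiliser projects onto all scaling factors ⇒ contains a
one-parameter spiral scaling);
the explicit values of κ and c₀ (kit job, later); uniqueness of the extremal element modulo
symmetries; the A ≠ 0 rungs of crux 3;
everything about NoTypeII (shared, attacked elsewhere). All are layer-2 children or prover-side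
lemmas (`--supports`).

CHEAPEST FALSIFIER. Run the mechanism on the truncated dyadic model, where the Type-I ancient class
is NONEMPTY and explicit
(Literature.Barriers.NavierStokesRegularity.TruncatedDyadicTypeIBlowup and
TruncatedDyadic.Tao2016_prop51_dss, machine-checked):
minimise the ℓ^∞-in-scale Type-I amplitude over its ancient DSS cascades and check whether the
minimiser is exactly DSS with NO
continuous scaling symmetry — expected yes, which does not kill the line but LOCATES crux 2: any
proof must use structure the
cascade lacks (exact similarity algebra, pressure, the hot-spot conditions of HotSpotFirstOrder).
Second: a kit evaluation of
κ = sup_τ √τ‖K(τ,·)‖_{L¹} and c₀ = 1/(πκ) against Leray's rate constant and Chae–Wolf's λ_*(C) (Thm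
1.3) — an inconsistency
flags an error in SmallConstantLiouville. Third: BoundedProfileConstant and SelfSimilarExcluded are
provable now from in-tree
Tsai machinery; failure to close them in one prover cycle signals a rendering problem of the gauge
class. Not run here (planner
seat; no kit in plancard mode).

NUMBERS. C*(u) = sup √(−t)|u| (temporal Type-I constant, scale- and translation-invariant); gap c₀ =
1/(πκ) (this route); Leray's lower
rate ‖u(t)‖_∞ ≥ c√ν(T−t)^{-1/2} (Leray1934 (3.9); in tree leray_blowup_rate_top); DSS removal for 1
< λ < λ_*(C)
(ChaeWolf2017RemovingDSS Thm 1.3); rotated self-similar Liouville with decaying profile for |α| <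
α_(C) and |α| > α‾(C)
(arXiv:2607.09619 Thm 1.4), open for α ≈ 1 and for bounded profiles; known Liouville cases inside
A_C: axisymmetric
(arXiv:0804.1803 Thm 1.1), |u| ≤ C/r (KNSS Thm 5.3), bounded Leray profile (Tsai1998 Thm 1, q = ∞).
Items at open: 13
(target, assembly, 3 cruxes, 8 support). LADDER CEILING (BC9): method_family=variational-extremality
type-I-ancient-liouville rotated-self-similar-profile; ladder_ceiling=capped-at-NoTypeIBlowup (a
Liouville theorem for the Type-I ancient class excludes Type-I blow-up and nothing more:
Seregin2014Notes §6.3 pp.113–114; KNSS2009 §1; axisymmetric singularities must be Type II,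
arXiv:2607.09619 p.4 fn.6; Tao's averaged class even has a Type-I blow-up, AveragedTypeIBlowup);
ceiling_lift=NoTypeII [declared-crux: NoTypeII, residual];
ceiling_sources=[corpus:book:seregin2014-lecture-notes-regularity-theory-navier-stokes-equations
p.113–114 | corpus:paper:arxiv-2607.09619 p.3–4 |
Literature/Barriers/NavierStokesRegularity/AveragedTypeIBlowup.lean |
…/LeraySelfSimilarBlowupExclusion.lean | …/NearOneDssTypeIExclusion.lean]; inside the Type-I tier
crux 3's profile-Liouville sub-ladder is capped at α = 0 (Tsai1998 Thm 1, NecasRuzickaSverak1996),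
extreme |α| with decaying profile (arXiv:2607.09619 Thm 1.4) and DSS factors near 1
(ChaeWolf2017RemovingDSS Thm 1.3); the lift inside the tier is crux 3 itself.

DEFINITION REQUESTS. None: heatFlow, oseenKernel, HasTypeITimeDecay, timeDeriv, IsLerayProfile,
IsClassicalNSSolutionOn and the blow-up vocabulary exist under Literature.Analysis.FluidPDE;
'isolated modulo symmetries' is avoided on purpose — Conjecture M is filed through its operative
consequence (spiral-scaling invariance).

Novelty: Searches (2026-08-15): `lit search --hybrid "minimal Type I constant ancient solution Navier-Stokes
extremal Liouville"` (12 held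
books: Seregin2014Notes pp.109–114, Lemarié-Rieusset 2016, RRS2016 — conjecture (L), Type-I zoom, no
extremal-constant analysis);
`lit search --source zbmath "ancient solution Navier-Stokes Liouville type I"` (3: arXiv:1811.00502,
arXiv:1011.5066,
arXiv:1903.09969); `lit search --source zbmath "minimal blow-up Navier-Stokes critical"` (9: minimal
DATA only — arXiv:1012.0145,
arXiv:1505.06197, arXiv:1804.09842, arXiv:1802.03164); `lit search --source zbmath "Merle … minimal
mass"` (1:
doi:10.1215/s0012-7094-93-06919-0); `lit galaxy search "minimal mass blow-up" --star all` (10 pdf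
hits, all NLS: arXiv:1001.1627,
arXiv:2007.15968, arXiv:2111.08443 …; no Navier–Stokes analogue); `lit galaxy search "bounded
ancient solution" --star all` (1:
Seregin's notes); `lit galaxy search "self-similar singularities" --star pdf` (11, Euler/CGL/shell
models); `lit frontier
NavierStokesRegularity --since 2022` (30 rows: forward self-similar, non-uniqueness, ε-regularity —
nothing on extremal Type-I
constants); `lit bridges NavierStokesRegularity --cross any`; `lit read arxiv:2607.09619` pp.3–7
(RSS = scaling solitons, Rem 1.8;
Conj 1.1; Thm 1.4); openalex/s2 rate-limited (HTTP 429). In-tree: 48 NS route files read by title,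
SymmetryModuliCount /
RecurrentProfiles / TypeICertificateLadder / MinimalBlowupRigidity / MarginalTypeI / TypeILiouville
in full.
Nearest prior  [refs: 10.1215/s0012-7094-93-06919-0, 1811.00502, 1011.5066, 1903.09969, 1012.0145, 1505.06197, 1804.09842, 1802.03164, 1001.1627, 2007.15968, 2111.08443, 2607.09619, 0709.3599, 0911.0500, 1201.1592, doi:10.1215/s0012-7094-93-06919-0, arxiv:2607.09619]

Barriers (technique_class: variational-extremality liouville-rigidity): - technique_class: variational-extremality liouville-rigidity
- Literature.Barriers.NavierStokesRegularity.LeraySelfSimilarBlowupExclusion: USED as the closing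
theorem (Tsai1998 Thm 1 at q = ∞ → support BoundedProfileConstant), not suffered; the line lives or
dies on whether extremality forces the scaling symmetry that the barrier then punishes, and it
records honestly that the rotated half of that symmetry class is not yet punished by anything (crux
3).
- Literature.Barriers.NavierStokesRegularity.TruncatedDyadicTypeIBlowup: it does not evade it; the
bet is located: the model has a Type-I DSS blow-up, so there the Type-I class is nonempty and its
extremal element is (presumably) discretely but not continuously self-similar — crux 2 is false in
the model and any proof must use Navier–Stokes structure the cascade lacks (pressure and the exact
similarity algebra, entering through HotSpotFirstOrder and the linearised orthogonality conditions).
- Literature.Barriers.NavierStokesRegularity.TaoAveragedBlowup: Tao's averaged blow-up is Type II,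
so it bites only on the shared crux NoTypeII (conceded, as in TypeILiouville: the bet there is
backward uniqueness / fine structure); the Type-I half closes with rigidity of exact scaling
solitons (head-pressure maximum principle), structure an averaged bilinear form lacks.
- Literature.Barriers.NavierStokesRegularity.EnergySupercriticality: nothing energy-class is used as
a coercive quantity; C* is scale-invariant; the supercritical ∀-datum

Novelty grade: new-combination — ROUTE REVIEW (refuter, 2026-08-15). Joins (i) Merle/Raphaël–Szeftel 'minimal blow-up element ⇒ maximal symmetry ⇒ absent' (mass ↦ temporal Type-I constant C* over the KNSS Oseen-gauge ancient class) with (ii) KNSS/Albritton–Barker Type-I zoom + Tsai q=∞. Not found in the tree's KNSS/Oseen/Liouville  (refuter refuter-rreview-route-AtomisticToContinu-4a1d4216-0, 2026-08-15T14:03:00Z; prior: arXiv:0709.3599 (KNSS2009: Type-I ancient mild class, (L), Prop 4.1/6.1), arXiv:1811.00502 (Albritton–Barker), doi:10.1215/s0012-7094-93-06919-0 (Merle 1993), arXiv:1001.1627 (Raphaël–Szeftel), Tsai1998 Thm 1 q=∞ (in tree: IsLerayProfile.exists_eq_const_of_bounded), arXiv:2607.09619 (Pineau–Vicol RSS Liouville),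 ChaeWolf2017RemovingDSS Thm 1.3, in-tree routes SymmetryModuliCount, RecurrentProfiles)

sub-problem: NavierStokesRegularity · status: draft · opened planner-plancard-NavierStokesRegularity-Navie-55e9e4a6-0 2026-08-15T12:34:02Z · rev 4 · ledger route-NavierStokesRegularity-ExtremalTypeIConstant
GENERATED by the gate from the ledger (D-0016/17). Provers cite these decls: `theorem foo : Summit.NavierStokesRegularity.NavierStokesRegularity.Theses.ExtremalTypeIConstant.<Decl> := …` in Summits/NavierStokesRegularity/NavierStokesRegularity/Theorems/<Name>.lean.
-/

namespace Summit.NavierStokesRegularity.NavierStokesRegularity.Theses.ExtremalTypeIConstant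

open scoped BigOperators Topology Manifold Classical MeasureTheory ProbabilityTheory Matrix InnerProductSpace ComplexConjugate ContinuousMap
open Filter Set Function TopologicalSpace MeasureTheory

attribute [summit_statement] _root_.NavierStokesRegularity

open Literature.NS

/-- item stmt-NavierStokesRegularity-4050 · target · rank 0 · open · by planner
why it might fail: ¬X = one nontrivial Type-I ancient mild solution, e.g. a backward λ-DSS/RDSS profile (BradshawTsai2017CPDE Open Problem 5.1; Tsai2018 Conj 8.8–8.9) — open even for ONE discrete symmetry (ChaeWolf2017RemovingDSS: only λ≈1/small C); the truncated dyadic model has exactly such a Type-I DSS blow-up.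
sources: KNSS2009 = arXiv:0709.3599 §1 (L), §6 Prop 6.1, AlbrittonBarker2019 = arXiv:1811.00502 Thm 1.1 (Type-I singularity ⇔ nontrivial Type-I ancient mild solution), BradshawTsai2017CPDE §5 Open Problem 5.1, Tsai2018 Conj 8.8–8.9, ChaeWolf2017RemovingDSS Thm 1.3, Seregin2014Notes pp.109–114
[target] X = (L') in the KNSS gauge: every element of A_C := {u smooth on (-inf,0)xR^3, div-free,
KNSS-mild (Oseen integral equation u(t)(x) = heatFlow(u(s))(t-s)(x) - ∫_{τ∈(s,t)} ∫_y oseenKernel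
(t-τ) (x-y) (u τ y) (u τ y) for all s<t<0, i.e. u(t) = e^{(t-s)Δ}u(s) - oseenDuhamel 1 s u u t of
NSBoundedMildOseen.lean written out with the in-tree oseenKernel: the gauge without parasitic b(t) /
time-dependent Galilean frames; KNSS2009 §1 (1.7)-(1.9), Seregin2014Notes Def 6.3 p.109, p.113),
HasTypeITimeDecay C u (|u| <= C/sqrt(-t))} is identically zero on t<0. Equivalent to ForcedSymmetry
∧ SymmetricLiouville (Sketch.lean: X ⇒ each; both ⇒ X trivially). Implied by (L) =
stmt-NavierStokesRegularity-0057 (support LiouvilleConjectureImplies). Kills Type-I blow-up via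
LiouvilleKillsTypeI. [sources: KNSS2009 §1, §6 Prop 6.1; AlbrittonBarker2019 Thm 1.1;
Seregin2014Notes pp.109-114; SereginSverak2009 §4] -/
@[route_item "route-NavierStokesRegularity-ExtremalTypeIConstant", crux]
def TypeIAncientLiouville : Prop :=
  ∀ (C : ℝ) (u : ℝ → EuclideanSpace ℝ (Fin 3) → EuclideanSpace ℝ (Fin 3)), ContDiffOn ℝ (⊤ : ℕ∞) (Function.uncurry u) (Set.Iio 0 ×ˢ Set.univ) ∧ (∀ t < 0, Literature.Analysis.FluidPDE.VectorCalculus.IsDivFree (u t)) ∧ (∀ s t : ℝ, s < t → t < 0 → ∀ x, u t x = Literature.Analysis.FluidPDE.heatFlow (u s) (t - s) x - ∫ τ in Set.Ioo s t, ∫ y, Literature.Analysis.FluidPDE.oseenKernel (t - τ) (x - y) (u τ y) (u τ y)) ∧ Literature.Analysis.FluidPDE.HasTypeITimeDecay C u → ∀ t < 0, ∀ x, u t x = 0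

/-- item stmt-NavierStokesRegularity-8215 · crux · rank 2 · open · by planner
why it might fail: Minimisers of the sup-functional C*(u) = sup √(−t)|u| need not be isolated mod symmetries: the extremal may be only λ-DSS/RDSS (the truncated-dyadic Type-I blow-up IS exactly DSS) or lie in a continuum of symmetry-free extremals; Danskin conditions at one hot spot force no continuous symmetry.
sources: doi:10.1215/s0012-7094-93-06919-0 (Merle 1993: minimal-mass NLS blow-up = pseudo-conformal ground state — the imported rigidity template), arXiv:1001.1627 (Raphaël–Szeftel: existence and uniqueness of the minimal blow-up element), KenigKoch2011 ; GallagherKochPlanchon2016 (NS critical elements minimise a DATUM norm: compactness mod symmetries, no self-similarity conclusion), BradshawTsai2017CPDE §1 (RSS/RDSS classes), §5 Open Problem 5.1, ChaeWolf2017RemovingDSS Thm 1.3 (DSS removed only for λ < λ_*(C)), PineauVicol2026 = arXiv:2607.09619 Rem 1.8 (RSS = the general scaling solitons of NS)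
[crux] the card's Conjecture M ("C*-minimisers are isolated modulo translations and rotations, hence
scaling-fixed") in the operative form the assembly needs. Call (C,u) EXTREMAL if u ∈ A_C, the Type-I
bound is attained at the interior point (t,x) = (−1,0) (‖u(−1,0)‖ = C; √(−t) = 1 there), and C ≤ C′
whenever A_{C′} has a nontrivial element. Then every extremal (C,u) with C > 0 is invariant under a
one-parameter group of SPIRAL SCALINGS: there are a ∈ ℝ³ and a skew A (⟪Ax,x⟫ = 0) with ∇u·(a + x +
Ax) + u + 2t ∂_t u − Au ≡ 0 on t<0 — SymmetryModuliCount's generator L_ξ with ξ = (a, σ = 1, A); A =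
0 is exact backward self-similarity about (−a, 0) (extremality pins the blow-up time of the symmetry
to T′ = 0: a soliton about T′ > 0 has sup √(−t)|u| approached only as t → −∞, never attained).
Intended proof shape: Danskin one-sided derivatives of ε ↦ C*(w_ε)² along C¹ curves of the class
through u vanish in sign (orthogonality conditions ẇ·u = 0 at the hot spot for every ancient
linearised direction, identically satisfied by the 7 symmetry generators), second-order conditions
from the Hessian of F = (−t)|u|² at (−1,0), Type-I compactness makes 'isolated' = 'locally unique',
and a stabil -/
@[route_item "route-NavierStokesRegularity-ExtremalTypeIConstant", crux]
def ExtremalSpiralSymmetry : Prop :=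
  ∀ (C : ℝ) (u : ℝ → EuclideanSpace ℝ (Fin 3) → EuclideanSpace ℝ (Fin 3)), 0 < C → (ContDiffOn ℝ (⊤ : ℕ∞) (Function.uncurry u) (Set.Iio 0 ×ˢ Set.univ) ∧ (∀ t < 0, Literature.Analysis.FluidPDE.VectorCalculus.IsDivFree (u t)) ∧ (∀ s t : ℝ, s < t → t < 0 → ∀ x, u t x = Literature.Analysis.FluidPDE.heatFlow (u s) (t - s) x - ∫ τ in Set.Ioo s t, ∫ y, Literature.Analysis.FluidPDE.oseenKernel (t - τ) (x - y) (u τ y) (u τ y)) ∧ Literature.Analysis.FluidPDE.HasTypeITimeDecay C u) ∧ ‖u (-1) 0‖ = C ∧ (∀ (C' : ℝ) (u' : ℝ → EuclideanSpace ℝ (Fin 3) → EuclideanSpace ℝ (Fin 3)), (ContDiffOn ℝ (⊤ : ℕ∞) (Function.uncurry u') (Set.Iio 0 ×ˢ Set.univ) ∧ (∀ t < 0, Literature.Analysis.FluidPDE.VectorCalculus.IsDivFree (u' t)) ∧ (∀ s t : ℝ, s < t → t < 0 → ∀ x, u' t x = Literature.Analysis.FluidPDE.heatFlow (u' s) (t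 - s) x - ∫ τ in Set.Ioo s t, ∫ y, Literature.Analysis.FluidPDE.oseenKernel (t - τ) (x - y) (u' τ y) (u' τ y)) ∧ Literature.Analysis.FluidPDE.HasTypeITimeDecay C' u') → (∃ t < 0, ∃ x, u' t x ≠ 0) → C ≤ C') → (∃ (a : EuclideanSpace ℝ (Fin 3)) (A : EuclideanSpace ℝ (Fin 3) →L[ℝ] EuclideanSpace ℝ (Fin 3)), (∀ x, inner ℝ (A x) x = 0) ∧ ∀ t < 0, ∀ x, fderiv ℝ (u t) x (a + x + A x) + u t x + (2 * t) • Literature.Analysis.FluidPDE.timeDeriv u t x - A (u t x) = 0)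

/-- item stmt-NavierStokesRegularity-8216 · crux · rank 3 · open · by planner
why it might fail: The rotated case A ≠ 0 (Perelman's RSS ansatz) is open even for DECAYING profiles |U| ≲ 1/(1+|y|) when α ≈ 1: PineauVicol2026 Thm 1.4 covers only |α| ≪ 1, ≫ 1 (Tsai2018 Conj 8.9 = BT2017 Open Problem 5.2); here U is merely bounded and no head-pressure maximum principle survives α(JU − Jy·∇U).
sources: PineauVicol2026 = arXiv:2607.09619 Conj 1.1, Rem 1.2–1.3, Thm 1.4; p.4 'leaves open the case α≈1', central obstruction = no Bernoulli-type maximum principle for α≠0 (pages read), Tsai1998 Thm 1 (q = ∞: a bounded Leray profile is constant — the A = 0 case; in tree via tsai1998_lemma32_holds + TsaiProfileEndgame), NecasRuzickaSverak1996 Thm 1, BradshawTsai2017Rotational = arXiv:1610.05680 (1.6)–(1.9), §5 Open Problems 5.1–5.2, Tsai2018 Conj 8.9, Literature.Barriers.NavierStokesRegularity.LeraySelfSimilarBlowupExclusion (covers A = 0 only)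
[crux] an element of A_C invariant under a one-parameter spiral-scaling group (generator ∇u·(a + x +
Ax) + u + 2t∂_t u − Au = 0, A skew) vanishes identically. Integrating the symmetry, u(t,x) =
(−t)^{-1/2} e^{−θ(t)A} U(e^{θ(t)A}(x − x₁)/√(−t)), θ(t) = −½ log(−t), x₁ = −(1+A)⁻¹a: a backward
ROTATED self-similar solution (scaling soliton) with smooth profile that is merely BOUNDED (|U| ≤ C;
no spatial decay). A = 0: (U,P) is a Leray profile with ν = 1, a = 1/2, U is constant by Tsai1998
Thm 1 at q = ∞ (support BoundedProfileConstant) and constants b/√(−t) violate the Oseen identity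
unless b = 0 (support SelfSimilarExcluded). A ≠ 0: bounded-profile rotated-self-similar Liouville.
Implied by SymmetryModuliCount.SymmetricLiouville (stmt-4053; σ = 1 case, checked in Sketch.lean),
strictly weaker (no translation/screw-motion cases). [deps: BoundedProfileConstant,
SelfSimilarExcluded] [difficulty: L] -/
@[route_item "route-NavierStokesRegularity-ExtremalTypeIConstant", crux]
def SpiralScalingLiouville : Prop :=
  ∀ (C : ℝ) (u : ℝ → EuclideanSpace ℝ (Fin 3) → EuclideanSpace ℝ (Fin 3)), ContDiffOn ℝ (⊤ : ℕ∞) (Function.uncurry u) (Set.Iio 0 ×ˢ Set.univ) ∧ (∀ t < 0, Literature.Analysis.FluidPDE.VectorCalculus.IsDivFree (u t)) ∧ (∀ s t : ℝ, s < t → t < 0 → ∀ x, u t x = Literature.Analysis.FluidPDE.heatFlow (u s) (t - s) x - ∫ τ in Set.Ioo s t, ∫ y, Literature.Analysis.FluidPDE.oseenKernel (t - τ) (x - y) (u τ y) (u τ y)) ∧ Literature.Analysis.FluidPDE.HasTypeITimeDecay C u → (∃ (a : EuclideanSpace ℝ (Fin 3)) (A : EuclideanSpace ℝ (Fin 3)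 →L[ℝ] EuclideanSpace ℝ (Fin 3)), (∀ x, inner ℝ (A x) x = 0) ∧ ∀ t < 0, ∀ x, fderiv ℝ (u t) x (a + x + A x) + u t x + (2 * t) • Literature.Analysis.FluidPDE.timeDeriv u t x - A (u t x) = 0) → ∀ t < 0, ∀ x, u t x = 0

/-- item stmt-NavierStokesRegularity-0056 · crux · rank 4 · open · by planner
why it might fail: No theorem bounds a blow-up rate from above; Tao's averaged-NS blow-up is Type II (arXiv:1402.0290 p.8 fn.), so averaging-insensitive methods cannot prove it; every axisymmetric singularity is Type II (KNSS2009 p.4), so Hou's candidate (arXiv:2107.06509), if real, refutes it (= ¬Clay A).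
sources: Tao2016AveragedNS = arXiv:1402.0290 §1.1 p.8 footnote (averaged blow-up is Type II), KNSS2009 = arXiv:0709.3599 p.4, Thms 6.1–6.2 (axisymmetric singularities are Type II), Hou2022PotentiallySingularNS = arXiv:2107.06509, Seregin2012 = arXiv:1104.3615 Thm 1.1; EscauriazaSereginSverak2003 Thms 1.3–1.4, Leray1934 §20 (3.9) = Literature.Analysis.FluidPDE.leray_blowup_rate_top; Tao2021QuantitativeNS = arXiv:1908.04958 Thm 1.4, Literature.Barriers.NavierStokesRegularity.TaoAveragedBlowup
If a finite-energy classical solution from a rapidly decaying datum has maximal lifespan T<∞ (no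
classical extension past T), then ‖u(t)‖_∞ ≤ C (T−t)^{-1/2} eventually as t↑T (Leray's rate is the
matching lower bound, leray_blowup_rate_top). The hardest and most informative crux: a
counterexample is a Type II singularity, i.e. ¬(Clay A). Known: lower bound c√ν (T−t)^{-1/2} (Leray
1934 §20); L³ must blow up (ESS 2003, Seregin 2012); only triple-log quantitative gain (Tao 2021). -/
@[route_item "route-NavierStokesRegularity-ExtremalTypeIConstant", crux]
def NoTypeII : Prop :=
  ∀ (ν T : ℝ), 0 < ν → 0 < T → ∀ (u : ℝ → EuclideanSpace ℝ (Fin 3) → EuclideanSpace ℝ (Fin 3)) (p : ℝ → EuclideanSpace ℝ (Fin 3) → ℝ), Literature.Analysis.FluidPDE.IsMaximalSmoothSolution ν 0 u p T → Literature.Analysis.FluidPDE.IsLerayHopfOn T ν 0 (u 0) u → Literature.Analysis.FluidPDE.HasRapidSpatialDecay (u 0) → Literature.Analysis.FluidPDE.IsTypeIBlowup u T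

/-- item stmt-NavierStokesRegularity-0055 · support · rank 9 · closed · proved by Summit.NavierStokesRegularity.NavierStokesRegularity.Theorems.typeICertificateLadder_noBlowupToClay_proof @ f501e9774e4d (prover) · by planner
sources: Leray1934, FujitaKato1964, Fefferman2000
Given NoBlowup, build the Clay (A) solution: local finite-energy classical solution for smooth
divergence-free rapidly decaying data (Leray 1934 §III / Fujita–Kato 1964 + LPS smoothing), continue
past every T using NoBlowup, glue by weak–strong uniqueness (Prodi–Serrin), bounded energy from the
energy inequality, and convert with
Literature.Analysis.FluidPDE.isNavierStokesSolution_and_smooth_iff. Blow-up at spatial infinity is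
excluded by CKN ε-regularity applied far out. May take named Literature facts (leray_existence_R3,
ladyzhenskaya_prodi_serrin, weak_strong_uniqueness, fujita_kato_local) as hypotheses if the grounder
so rules. -/
@[route_item "route-NavierStokesRegularity-ExtremalTypeIConstant"]
def NoBlowupToClay : Prop :=
  (∀ (ν T : ℝ), 0 < ν → 0 < T → ∀ (u : ℝ → EuclideanSpace ℝ (Fin 3) → EuclideanSpace ℝ (Fin 3)) (p : ℝ → EuclideanSpace ℝ (Fin 3) → ℝ), Literature.Analysis.FluidPDE.IsClassicalNSSolutionOn (Set.Ico 0 T) ν 0 u p → Literature.Analysis.FluidPDE.IsLerayHopfOn T ν 0 (u 0) u → Literature.Analysis.FluidPDE.HasRapidSpatialDecay (u 0) → Literature.Analysis.FluidPDE.HasSmoothExtensionPast ν 0 u T) → NavierStokesRegularity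

/-- `NoBlowupToClay` holds: proved by `Summit.NavierStokesRegularity.NavierStokesRegularity.Theorems.typeICertificateLadder_noBlowupToClay_proof` @ f501e9774e4d. -/
theorem NoBlowupToClay_holds : NoBlowupToClay := _root_.Summit.NavierStokesRegularity.NavierStokesRegularity.Theorems.typeICertificateLadder_noBlowupToClay_proof

/-- item stmt-NavierStokesRegularity-4056 · support · rank 9 · closed · proved by Summit.NavierStokesRegularity.NavierStokesRegularity.Theorems.symmetryModuliCount_liouvilleKillsTypeI_proof (prover) · by planner
sources: arXiv:0709.3599, arXiv:0804.1803, Seregin2014Notes, arXiv:1811.00502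
[support, glue in the assembly; KNOWN argument] X ⇒ a finite-energy classical solution (u,p) on
[0,T) from a rapidly decaying datum with Type-I rate ‖u(t)‖_∞ ≤ C(T−t)^{-1/2} near T extends
smoothly past T. Proof (KNSS2009 §6 Prop 6.1 + Lemma 6.1; SereginSverak2009 §4; Seregin2014Notes
Prop 3.10-3.11 pp.111-114; AlbrittonBarker2019 §3): if not, u is unbounded near T (continuation fact
hasSmoothExtensionPast_of_bounded, KNSSTypeII.lean); zoom at near-maxima, u_k(s,y) = M_k^{-1} u(t_k
+ s/M_k², x_k + y/M_k), M_k = sup_{t≤t_k}‖u‖_∞ → ∞: |u_k| ≤ 1 on s ≤ 0, |u_k(0,0)| ≥ 1/2, and the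
Type-I rate gives |u_k(s,·)| ≤ C/√(M_k²(T−t_k) − s) ≤ C/√(−s) with the SAME C; KNSS Prop 4.1 bounds
(fact knss2009_smoothing) + Arzelà–Ascoli give a C^∞_loc limit ū on (−∞,0]×R^3 which is div-free,
satisfies the Oseen integral equation (dominated convergence in oseenDuhamel; kernel bound (14)),
HasTypeITimeDecay C, and |ū(0,0)| ≥ 1/2; X forces ū ≡ 0 on s < 0, contradicting continuity at s = 0.
May take the named facts knss2009_smoothing / hasSmoothExtensionPast_of_bounded as hypotheses if the
grounder so rules. Its (L)-version is stmt-NavierStokesRegularity-0058. [sources: KNSS2009 §6;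
SereginSverak2009 §4; -/
@[route_item "route-NavierStokesRegularity-ExtremalTypeIConstant"]
def LiouvilleKillsTypeI : Prop :=
  (∀ (C : ℝ) (u : ℝ → EuclideanSpace ℝ (Fin 3) → EuclideanSpace ℝ (Fin 3)), ContDiffOn ℝ (⊤ : ℕ∞) (Function.uncurry u) (Set.Iio 0 ×ˢ Set.univ) ∧ (∀ t < 0, Literature.Analysis.FluidPDE.VectorCalculus.IsDivFree (u t)) ∧ (∀ s t : ℝ, s < t → t < 0 → ∀ x, u t x = Literature.Analysis.FluidPDE.heatFlow (u s) (t - s) x - ∫ τ in Set.Ioo s t, ∫ y, Literature.Analysis.FluidPDE.oseenKernel (t - τ) (x - y) (u τ y) (u τ y)) ∧ Literature.Analysis.FluidPDE.HasTypeITimeDecay C u → ∀ t < 0, ∀ x, u t x = 0) → ∀ (ν T : ℝ), 0 < ν → 0 < T → ∀ (u : ℝ → EuclideanSpace ℝ (Fin 3) → EuclideanSpace ℝ (Fin 3)) (p : ℝ → EuclideanSpace ℝ (Fin 3) → ℝ), Literature.Analysis.FluidPDE.IsClassicalNSSolutionOn (Set.Ico 0 T) ν 0 u p → Literature.Analysis.FluidPDE.IsLerayHopfOn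 T ν 0 (u 0) u → Literature.Analysis.FluidPDE.HasRapidSpatialDecay (u 0) → Literature.Analysis.FluidPDE.IsTypeIBlowup u T → Literature.Analysis.FluidPDE.HasSmoothExtensionPast ν 0 u T

/-- `LiouvilleKillsTypeI` holds: proved by `Summit.NavierStokesRegularity.NavierStokesRegularity.Theorems.symmetryModuliCount_liouvilleKillsTypeI_proof`. -/
theorem LiouvilleKillsTypeI_holds : LiouvilleKillsTypeI := _root_.Summit.NavierStokesRegularity.NavierStokesRegularity.Theorems.symmetryModuliCount_liouvilleKillsTypeI_proof

/-- item stmt-NavierStokesRegularity-8217 · support · rank 9 · closed · proved by Summit.NavierStokesRegularity.NavierStokesRegularity.Theorems.extremalTypeIConstant_minimiserExists_proof (prover) · by planner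
sources: arXiv:0709.3599, Seregin2014Notes, arXiv:1811.00502, KochTataru2001
[support] attainment (card (d)): if some A_C has a nontrivial element then an EXTREMAL (C*,w) with
C* > 0 exists. Proof: C* := inf of admissible constants of nontrivial elements is ≥ c₀ > 0 by
SmallConstantLiouville; take u_k ∈ A_{C_k} nontrivial, C_k ↓ C*, points (t_k,x_k) with
√(−t_k)|u_k(t_k,x_k)| ≥ C*(u_k) − 1/k ≥ C* − 1/k; renormalise by the class-preserving symmetries x_k
↦ 0 (translation), t_k ↦ −1 (parabolic scaling); KNSS §4 smoothing bounds (Prop 4.1: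
t^{k/2+l}∇^k∂_t^l u bounded in terms of ‖u‖_∞ on windows) give C^∞_loc compactness on (−∞,0)×ℝ³; the
limit w is smooth, divergence-free, obeys |w| ≤ C*/√(−t) pointwise, satisfies the Oseen identity for
all s<t<0 (dominated convergence: |K(τ,z)| ≤ c(√τ+|z|)^{-4}, Koch–Tataru (14)), and ‖w(−1,0)‖ = lim
≥ C*, hence = C*; minimality of C* is its definition. [difficulty: L] -/
@[route_item "route-NavierStokesRegularity-ExtremalTypeIConstant", crux]
def MinimiserExists : Prop :=
  (∃ (C : ℝ) (u : ℝ → EuclideanSpace ℝ (Fin 3) → EuclideanSpace ℝ (Fin 3)), (ContDiffOn ℝ (⊤ : ℕ∞) (Function.uncurry u) (Set.Iio 0 ×ˢ Set.univ) ∧ (∀ t < 0, Literature.Analysis.FluidPDE.VectorCalculus.IsDivFree (u t)) ∧ (∀ s t : ℝ, s < t → t < 0 → ∀ x, u t x = Literature.Analysis.FluidPDE.heatFlow (u s) (t - s) x - ∫ τ in Set.Ioo s t, ∫ y, Literature.Analysis.FluidPDE.oseenKernel (t - τ) (x - y) (u τ y) (u τ y)) ∧ Literature.Analysis.FluidPDE.HasTypeITimeDecay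 C u) ∧ (∃ t < 0, ∃ x, u t x ≠ 0)) → ∃ (C : ℝ) (u : ℝ → EuclideanSpace ℝ (Fin 3) → EuclideanSpace ℝ (Fin 3)), 0 < C ∧ (ContDiffOn ℝ (⊤ : ℕ∞) (Function.uncurry u) (Set.Iio 0 ×ˢ Set.univ) ∧ (∀ t < 0, Literature.Analysis.FluidPDE.VectorCalculus.IsDivFree (u t)) ∧ (∀ s t : ℝ, s < t → t < 0 → ∀ x, u t x = Literature.Analysis.FluidPDE.heatFlow (u s) (t - s) x - ∫ τ in Set.Ioo s t, ∫ y, Literature.Analysis.FluidPDE.oseenKernel (t - τ) (x - y) (u τ y) (u τ y)) ∧ Literature.Analysis.FluidPDE.HasTypeITimeDecay C u) ∧ ‖u (-1) 0‖ = C ∧ (∀ (C' : ℝ) (u' : ℝ → EuclideanSpace ℝ (Fin 3) → EuclideanSpace ℝ (Fin 3)), (ContDiffOn ℝ (⊤ : ℕ∞) (Function.uncurry u') (Set.Iio 0 ×ˢ Set.univ) ∧ (∀ t < 0, Literature.Analysis.FluidPDE.VectorCalculus.IsDivFree (u' t)) ∧ (∀ s t : ℝ, s < t → t < 0 → ∀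 x, u' t x = Literature.Analysis.FluidPDE.heatFlow (u' s) (t - s) x - ∫ τ in Set.Ioo s t, ∫ y, Literature.Analysis.FluidPDE.oseenKernel (t - τ) (x - y) (u' τ y) (u' τ y)) ∧ Literature.Analysis.FluidPDE.HasTypeITimeDecay C' u') → (∃ t < 0, ∃ x, u' t x ≠ 0) → C ≤ C')

/-- item stmt-NavierStokesRegularity-8218 · support · rank 9 · closed · proved by Summit.NavierStokesRegularity.NavierStokesRegularity.Theorems.extremalTypeIConstant_smallConstantLiouville_proof (prover) · by planner
sources: arXiv:0709.3599, KochTataru2001, ChaeWolf2017RemovingDSS, Seregin2014Notes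
[support] the GAP (card (c)), rung zero of TypeICertificateLadder in closed form: there is c₀ > 0 —
explicitly c₀ = 1/(πκ), κ := sup_{τ>0} √τ ‖K(τ,·)‖_{L¹(ℝ³)} the Oseen-kernel constant — with A_C =
{0} for C < c₀. Proof in the gauge: |e^{(t−s)Δ}u(s)| ≤ C/√(−s) → 0 as s → −∞ (temporal decay kills
the past) and |∫_s^t∫K(t−τ,x−y)[u,u]| ≤ κC²∫_{−∞}^t (t−τ)^{-1/2}(−τ)^{-1}dτ = πκC²/√(−t); so C*(u) ≤
πκ C*(u)², i.e. C*(u) = 0 or C*(u) ≥ 1/(πκ). [difficulty: provable-now] -/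
@[route_item "route-NavierStokesRegularity-ExtremalTypeIConstant"]
def SmallConstantLiouville : Prop :=
  ∃ c₀ : ℝ, 0 < c₀ ∧ ∀ (C : ℝ) (u : ℝ → EuclideanSpace ℝ (Fin 3) → EuclideanSpace ℝ (Fin 3)), ContDiffOn ℝ (⊤ : ℕ∞) (Function.uncurry u) (Set.Iio 0 ×ˢ Set.univ) ∧ (∀ t < 0, Literature.Analysis.FluidPDE.VectorCalculus.IsDivFree (u t)) ∧ (∀ s t : ℝ, s < t → t < 0 → ∀ x, u t x = Literature.Analysis.FluidPDE.heatFlow (u s) (t - s) x - ∫ τ in Set.Ioo s t, ∫ y, Literature.Analysis.FluidPDE.oseenKernel (t - τ) (x - y) (u τ y) (u τ y)) ∧ Literature.Analysis.FluidPDE.HasTypeITimeDecay C u → C < c₀ → ∀ t < 0, ∀ x, u t x = 0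

/-- item stmt-NavierStokesRegularity-8219 · support · rank 9 · closed · proved by Summit.NavierStokesRegularity.NavierStokesRegularity.Theorems.extremalTypeIConstant_selfSimilarExcluded_proof (prover) · by planner
sources: Tsai1998, NecasRuzickaSverak1996, arXiv:0709.3599
[support] the A = 0 case of SpiralScalingLiouville: an element of A_C that is exactly backward
self-similar about some (x₁, 0) (generator ∇u·(a + x) + u + 2t∂_t u = 0, x₁ = −a) vanishes.
Integrate: u(t,x) = (−t)^{-1/2}U((x−x₁)/√(−t)) with U = u(−1, x₁ + ·) smooth, |U| ≤ C; the gauge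
makes (u,p) a classical solution with the KNSS pressure, hence (U,P) a Leray profile (IsLerayProfile
1 (1/2) U P after translating x₁ to 0); BoundedProfileConstant gives U ≡ b; then u = b/√(−t) and the
Oseen identity u(t) = e^{(t−s)Δ}u(s) (the bilinear term of a constant field vanishes: K has zero
mean / is a derivative) forces b/√(−t) = b/√(−s), b = 0. [difficulty: M] -/
@[route_item "route-NavierStokesRegularity-ExtremalTypeIConstant"]
def SelfSimilarExcluded : Prop :=
  ∀ (C : ℝ) (u : ℝ → EuclideanSpace ℝ (Fin 3) → EuclideanSpace ℝ (Fin 3)), ContDiffOn ℝ (⊤ : ℕ∞) (Function.uncurry u) (Set.Iio 0 ×ˢ Set.univ) ∧ (∀ t < 0, Literature.Analysis.FluidPDE.VectorCalculus.IsDivFree (u t)) ∧ (∀ s t : ℝ, s < t → t < 0 → ∀ x, u t x = Literature.Analysis.FluidPDE.heatFlow (u s) (t - s) x - ∫ τ in Set.Ioo s t, ∫ y, Literature.Analysis.FluidPDE.oseenKernel (t - τ) (x - y) (u τ y) (u τ y)) ∧ Literature.Analysis.FluidPDE.HasTypeITimeDecay C u → (∃ (a : EuclideanSpace ℝ (Fin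 3)), ∀ t < 0, ∀ x, fderiv ℝ (u t) x (a + x) + u t x + (2 * t) • Literature.Analysis.FluidPDE.timeDeriv u t x = 0) → ∀ t < 0, ∀ x, u t x = 0

/-- item stmt-NavierStokesRegularity-8220 · support · rank 9 · closed · proved by Summit.NavierStokesRegularity.NavierStokesRegularity.Theorems.boundedProfileConstant_proof @ 02883de4a53b (prover) · by planner
sources: Tsai1998, NecasRuzickaSverak1996, Literature.Barriers.NavierStokesRegularity.LeraySelfSimilarBlowupExclusion
[support] Tsai 1998 Theorem 1 at q = ∞ for the tree's pointwise profile class: a Leray profile (U,P)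
(IsLerayProfile ν a U P, ν,a > 0) with U bounded is CONSTANT (print: "If a weak solution U of (1.3)
belongs to L^q(ℝ³) for some q ∈ (3,∞], then it must be constant"; the in-tree fact tsai_selfsimilar
records only q < ∞). Provable now from in-tree pieces: tsai1998_profile_smooth_holds (U ∈ C^∞),
tsai1998_lemma32_holds (polynomial pressure growth, stated for 3 ≤ q ≤ ⊤), |U| ≤ M ≤ b|y| for |y| ≥
M/b with any b ∈ (0,a), abs_headPressure_le + isConst_of_driftOp_nonneg_of_poly (Lemma 5.1: Π =
½|U|² + P + a y·U constant), IsLerayProfile.laplacian_eq_zero_of_headPressure_const_of_contDiff (ΔU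
= 0), then Liouville for BOUNDED harmonic maps in place of the L^q step of
IsLerayProfile.eq_zero_of_growth. [difficulty: provable-now] -/
@[route_item "route-NavierStokesRegularity-ExtremalTypeIConstant"]
def BoundedProfileConstant : Prop :=
  ∀ (ν a : ℝ), 0 < ν → 0 < a → ∀ (U : EuclideanSpace ℝ (Fin 3) → EuclideanSpace ℝ (Fin 3)) (P : EuclideanSpace ℝ (Fin 3) → ℝ), Literature.Analysis.FluidPDE.IsLerayProfile ν a U P → (∃ M : ℝ, ∀ y, ‖U y‖ ≤ M) → ∃ b : EuclideanSpace ℝ (Fin 3), ∀ y, U y = b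

/-- item stmt-NavierStokesRegularity-8221 · support · rank 9 · closed · proved by Summit.NavierStokesRegularity.NavierStokesRegularity.Theorems.extremalTypeIConstant_hotSpotFirstOrder_proof @ c26f1f606469 (prover) · by planner
sources: arXiv:0709.3599, Seregin2014Notes
[support] first-order conditions at the hot spot of an extremal element (card (e)). F(t,x) =
(−t)|u(t,x)|² ≤ C² on t<0 with equality at (−1,0), an INTERIOR point, so: ∇_x|u(−1,·)|²(0) = 0;
∂_t|u(·,0)|²(−1) = C² (from ∂_tF = 0); Δ_x|u(−1,·)|²(0) ≤ 0. The gauge makes (u,p) a classical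
Navier–Stokes solution on t<0 for the KNSS pressure p (KNSS §4; any admissible p has the same ∇p),
and ∂_t|u|²/2 = u·Δu − u·(u·∇)u − u·∇p = Δ|u|²/2 − |∇u|² − ½u·∇|u|² − u·∇p gives at (−1,0) the
PRESSURE PUSH −u·∇p ≥ C²/2 + |∇u|² (so |∇p(−1,0)| ≥ C/2): the extremal ancient flow is being
accelerated by pressure at its hot spot by a quantified, scale-invariant amount. Seed of the
first-order analysis behind crux 2. [difficulty: M] -/
@[route_item "route-NavierStokesRegularity-ExtremalTypeIConstant"]
def HotSpotFirstOrder : Prop :=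
  ∀ (C : ℝ) (u : ℝ → EuclideanSpace ℝ (Fin 3) → EuclideanSpace ℝ (Fin 3)), 0 < C → (ContDiffOn ℝ (⊤ : ℕ∞) (Function.uncurry u) (Set.Iio 0 ×ˢ Set.univ) ∧ (∀ t < 0, Literature.Analysis.FluidPDE.VectorCalculus.IsDivFree (u t)) ∧ (∀ s t : ℝ, s < t → t < 0 → ∀ x, u t x = Literature.Analysis.FluidPDE.heatFlow (u s) (t - s) x - ∫ τ in Set.Ioo s t, ∫ y, Literature.Analysis.FluidPDE.oseenKernel (t - τ) (x - y) (u τ y) (u τ y)) ∧ Literature.Analysis.FluidPDE.HasTypeITimeDecay C u) ∧ ‖u (-1) 0‖ = C ∧ (∀ (C' : ℝ) (u' : ℝ → EuclideanSpace ℝ (Fin 3) → EuclideanSpace ℝ (Fin 3)), (ContDiffOn ℝ (⊤ : ℕ∞) (Function.uncurry u') (Set.Iio 0 ×ˢ Set.univ) ∧ (∀ t < 0, Literature.Analysis.FluidPDE.VectorCalculus.IsDivFree (u' t)) ∧ (∀ s t : ℝ, s < t → t < 0 → ∀ x, u' t x = Literature.Analysis.FluidPDE.heatFlow (u' s) (t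 - s) x - ∫ τ in Set.Ioo s t, ∫ y, Literature.Analysis.FluidPDE.oseenKernel (t - τ) (x - y) (u' τ y) (u' τ y)) ∧ Literature.Analysis.FluidPDE.HasTypeITimeDecay C' u') → (∃ t < 0, ∃ x, u' t x ≠ 0) → C ≤ C') → fderiv ℝ (fun x => ‖u (-1) x‖ ^ 2) 0 = 0 ∧ Literature.Analysis.FluidPDE.timeDeriv (fun t x => ‖u t x‖ ^ 2) (-1) 0 = C ^ 2 ∧ Laplacian.laplacian (fun x => ‖u (-1) x‖ ^ 2) 0 ≤ 0 ∧ ∃ p : ℝ → EuclideanSpace ℝ (Fin 3) → ℝ, Literature.Analysis.FluidPDE.IsClassicalNSSolutionOn (Set.Iio 0) 1 0 u p ∧ C ^ 2 / 2 + Literature.Analysis.FluidPDE.frobeniusNormSq (fderiv ℝ (u (-1)) 0) ≤ -(inner ℝ (u (-1) 0) (gradient (p (-1)) 0))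

/-- item stmt-NavierStokesRegularity-8222 · support · rank 9 · closed · proved by Summit.NavierStokesRegularity.NavierStokesRegularity.Theorems.extremalTypeIConstant_targetOfCruxes_proof (prover) · by planner
sources: arXiv:0709.3599, doi:10.1215/s0012-7094-93-06919-0
[support] GLUE cruxes ⇒ target, pure logic (PROVED in the planner's Sketch.lean, theorem
targetOfCruxes_holds): ExtremalSpiralSymmetry → SpiralScalingLiouville → MinimiserExists →
TypeIAncientLiouville. Given a nontrivial u ∈ A_C, MinimiserExists yields an extremal (C*,w) with
‖w(−1,0)‖ = C* > 0, crux 2 gives its spiral-scaling symmetry, crux 3 makes w ≡ 0 on t<0 —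
contradiction with ‖w(−1,0)‖ = C* > 0. [difficulty: provable-now] -/
@[route_item "route-NavierStokesRegularity-ExtremalTypeIConstant"]
def TargetOfCruxes : Prop :=
  ExtremalSpiralSymmetry → SpiralScalingLiouville → MinimiserExists → TypeIAncientLiouville

/-- item stmt-NavierStokesRegularity-8223 · assembly · rank 1 · closed · proved by Summit.NavierStokesRegularity.NavierStokesRegularity.Theorems.extremalTypeIConstant_assembly_proof (prover) · by planner
sources: Fefferman2000, arXiv:0709.3599
[assembly] ExtremalSpiralSymmetry → SpiralScalingLiouville → MinimiserExists → LiouvilleKillsTypeI →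
NoTypeII → NoBlowupToClay → NavierStokesRegularity. -/
@[route_item "route-NavierStokesRegularity-ExtremalTypeIConstant"]
def Assembly : Prop :=
  ExtremalSpiralSymmetry → SpiralScalingLiouville → MinimiserExists → LiouvilleKillsTypeI → NoTypeII → NoBlowupToClay → NavierStokesRegularity

/-! D-0027 §2.1 — DECIDING THEOREM (planner-authored via `route open/edit --closes-file`; by planner-rbadge-NavierStokesRegularity-Extremal-6af16f19-g3-0 2026-08-17T18:19:31Z):
its hypotheses are this route's items and its conclusion the sub-problem Statement (glue_lint), and it elaborates with this file. -/

/-- DECIDING THEOREM (route-repair g3, 2026-08-17): the proved support frames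
`LiouvilleKillsTypeI` (stmt-4056) and `NoBlowupToClay` (stmt-0055) are no longer binders — they are
consumed through their gate-appended `_holds` theorems, so the tribunal's strength test sees only the
open Type-I cruxes `ExtremalSpiralSymmetry`, `SpiralScalingLiouville`, the proved frame
`MinimiserExists` (its proof file imports this module, so it must stay a binder) and the declared
RESIDUAL conjunct `NoTypeII` (the Type-II half of the Clay dichotomy, imported, not attacked). -/
@[closes "route-NavierStokesRegularity-ExtremalTypeIConstant"] theorem closes : ExtremalSpiralSymmetry → SpiralScalingLiouville → MinimiserExists →
    NoTypeII → NavierStokesRegularity := by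
  intro hSym hLiou hMin hNoII
  have hX : TypeIAncientLiouville := by
    intro C u hu t ht x
    by_contra hne
    obtain ⟨C₀, w, hC₀, hw, hnorm, hminimal⟩ := hMin ⟨C, u, hu, t, ht, x, hne⟩
    obtain ⟨a, A, hA, hsym⟩ := hSym C₀ w hC₀ ⟨hw, hnorm, hminimal⟩
    have hzero : w (-1) 0 = 0 := hLiou C₀ w hw ⟨a, A, hA, hsym⟩ (-1) (by norm_num) 0
    rw [hzero, norm_zero] at hnorm
    exact absurd hnorm (ne_of_lt hC₀)
  refine NoBlowupToClay_holds ?_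
  intro ν T hν hT u p hcl hLH hdec
  by_contra hne
  exact hne (LiouvilleKillsTypeI_holds hX ν T hν hT u p hcl hLH hdec
    (hNoII ν T hν hT u p ⟨hcl, hne⟩ hLH hdec))

end Summit.NavierStokesRegularity.NavierStokesRegularity.Theses.ExtremalTypeIConstant
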